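import Mathlib
import Summits.Ventures.HodgeRepro.Tier4.Line4.LatticeCount
import Summits.Ventures.HodgeRepro.Tier4.Line4.TorusProduct

/-!
# Tier4/Line4/TorusFin — C-L4-TORUSFIN: the rational torus points in a compact are finitely many, with a bound uniform in
the translate; on the anisotropic plane `T(k) ∩ (T_∞ × K_f)` is finite for every compact `K_f`

Blind re-derivation cell `pub-hodge-repro`, Tier 4 «PROVE THE STEP», LINE L4, seat t4-x2 (g4, reserve wall-breaker),
lead (R-24) S15009: «`T(k) ∩ (K_f × T_∞)` is FINITE with a bound `F` uniform in the compact — discrete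
(`rationalPoints_discrete`) in compact (`KTypeData.compactT` / `compactT'`)».  Tree path
`lean/Summits/Ventures/HodgeRepro/Tier4/Line4/TorusFin.lean`.  0 print, no `def`.

THE MATHEMATICS.  `T(k) = S.Tk ⊆ S.Gk` is a subgroup of the discrete subgroup `G(k)`; L4-p2 g4's uniform lattice count
(LatticeCount p698541, `exists_card_le_of_isCompact`: `#(G(k) ∩ g K) ≤ n` for EVERY `g`, by discreteness alone) restricts
to it — `#(T(k) ∩ g K) ≤ n` for every `g ∈ G` (§1).  On the adelic group, when the archimedean torus `T_∞ = T(𝔸) ∩ G_∞`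
is compact (`CompactSpace (torusInf W)`, the anisotropic plane: TorusInfCompact / KTypeData `compactT`), a rational torus
point `τ` with finite part `τ_f ∈ K_f` lies in the compact `T_∞ · K_f` (`τ = τ_∞ τ_f`, `τ_∞ ∈ T_∞`), so §1 gives the
bound `F = F(K_f)`, uniform in the translate and in everything else (§2; the `T′` twin).

* `exists_card_le_tk_of_isCompact` / `exists_card_le_t'k_of_isCompact` — generic `S : Setting G`, any compact `K`:
  `∃ n, ∀ g, ∀ s : Finset S.Tk, (∀ τ ∈ s, g⁻¹ * τ ∈ K) → s.card ≤ n`; the set forms `…_finite_…` (`Set.Finite` +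
  `Set.ncard ≤ n`).
* `isCompact_torusT_inter_infinitePart` / `…'` — `T(𝔸) ∩ G_∞` is a compact subset of `G(𝔸)` when `torusInf W` is a
  compact space (the range of `torusInf W → G(𝔸)`).
* `exists_card_le_tk_of_isCompact_finPart` / `…_t'k_…` — THE STATEMENT of (R-24): for `S.T ≤ torusT W`,
  `[CompactSpace (torusInf W)]` and a compact `K_f ⊆ G(𝔸)`: `∃ F, ∀ s : Finset S.Tk, (∀ τ ∈ s, GA.ofFinPart W τ ∈ K_f) →
  s.card ≤ F` (`mem_mul_of_ofFinPart_mem`: `τ = τ_∞ τ_f ∈ (T(𝔸) ∩ G_∞) · K_f`); set forms `…_finite_…`.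

HONEST SCOPE (wall-breaker's note, S15009): this bounds `#(T(k) ∩ compact)`; it is NOT by itself «the number of non-zero
terms of the orbit sum» `∑_{γ ∈ T(k) γ₁ T′(k)} f (t⁻¹ γ t′)` — those terms are indexed by PAIRS `(τ, τ′)` modulo the
stabiliser with the constraint on the PRODUCT `τ_f γ₁,f τ′_f`, and bounding them uniformly in the orbit needs the
properness of the orbit map at the finite places UNIFORMLY in `γ₁` over a compact (L2-p3's OrbitProper is per `γ₀`),
see the bus line.  Nothing here says anything about the status of the Hodge conjecture for CM abelian varieties, which
is NOT proved (HC_CM is NOT proved by anyone in this repository).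
-/

set_option autoImplicit false

noncomputable section

namespace Summit.Ventures.HodgeRepro.Tier4.Line4

open MeasureTheory Topology NumberField Summit.Ventures.HodgeRepro.Tier4.Common
  Summit.Ventures.HodgeRepro.Tier4.Line1 Summit.Ventures.HodgeRepro.Tier4.Line1.RTF

open scoped Pointwise

/-! ## 1. Generic: the rational torus points in a translate of a compact -/

section Generic

variable {G : Type} [Group G] [TopologicalSpace G] [IsTopologicalGroup G] [MeasurableSpace G] (S : Setting G)

omit [IsTopologicalGroup G] in
/-- The coercion `S.Tk → S.Gk` is injective (it is `Subtype.val`). -/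
theorem tk_coe_injective : Function.Injective (fun τ : S.Tk => (τ : S.Gk)) := Subtype.val_injective

omit [IsTopologicalGroup G] in
/-- The coercion `S.T'k → S.Gk` is injective. -/
theorem t'k_coe_injective : Function.Injective (fun τ : S.T'k => (τ : S.Gk)) := Subtype.val_injective

/-- **The uniform count of rational torus points** `#(T(k) ∩ g K) ≤ n` for every `g ∈ G` (L4-p2's
`exists_card_le_of_isCompact` restricted to the subgroup `T(k) ⊆ G(k)`). -/
theorem exists_card_le_tk_of_isCompact {K : Set G} (hK : IsCompact K) :
    ∃ n : ℕ, ∀ g : G, ∀ s : Finset S.Tk, (∀ τ ∈ s, g⁻¹ * ((τ : S.Gk) : G) ∈ K) → s.card ≤ n := by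
  classical
  obtain ⟨n, hn⟩ := exists_card_le_of_isCompact S hK
  refine ⟨n, fun g s hs => ?_⟩
  have := hn g (s.map ⟨fun τ : S.Tk => (τ : S.Gk), tk_coe_injective S⟩) ?_
  · simpa using this
  · intro γ hγ
    obtain ⟨τ, hτ, rfl⟩ := Finset.mem_map.1 hγ
    exact hs τ hτ

/-- The `T′` twin: `#(T′(k) ∩ g K) ≤ n` for every `g ∈ G`. -/
theorem exists_card_le_t'k_of_isCompact {K : Set G} (hK : IsCompact K) :
    ∃ n : ℕ, ∀ g : G, ∀ s : Finset S.T'k, (∀ τ ∈ s, g⁻¹ * ((τ : S.Gk) : G) ∈ K) → s.card ≤ n := by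
  classical
  obtain ⟨n, hn⟩ := exists_card_le_of_isCompact S hK
  refine ⟨n, fun g s hs => ?_⟩
  have := hn g (s.map ⟨fun τ : S.T'k => (τ : S.Gk), t'k_coe_injective S⟩) ?_
  · simpa using this
  · intro γ hγ
    obtain ⟨τ, hτ, rfl⟩ := Finset.mem_map.1 hγ
    exact hs τ hτ

/-- The set form: `{τ ∈ T(k) | g⁻¹ τ ∈ K}` is finite with at most `n` elements, for every `g`. -/
theorem exists_finite_tk_of_isCompact {K : Set G} (hK : IsCompact K) :
    ∃ n : ℕ, ∀ g : G, {τ : S.Tk | g⁻¹ * ((τ : S.Gk) : G) ∈ K}.Finite ∧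
      {τ : S.Tk | g⁻¹ * ((τ : S.Gk) : G) ∈ K}.ncard ≤ n := by
  classical
  obtain ⟨n, hn⟩ := exists_card_le_tk_of_isCompact S hK
  refine ⟨n, fun g => ?_⟩
  have hfin : {τ : S.Tk | g⁻¹ * ((τ : S.Gk) : G) ∈ K}.Finite := by
    by_contra hinf
    obtain ⟨F, hFsub, hFcard⟩ := (Set.not_finite.mp hinf).exists_subset_card_eq (n + 1)
    have := hn g F fun τ hτ => hFsub hτ
    omega
  refine ⟨hfin, ?_⟩
  rw [Set.ncard_eq_toFinset_card _ hfin]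
  exact hn g _ fun τ hτ => hfin.mem_toFinset.mp hτ

/-- The set form for `T′(k)`. -/
theorem exists_finite_t'k_of_isCompact {K : Set G} (hK : IsCompact K) :
    ∃ n : ℕ, ∀ g : G, {τ : S.T'k | g⁻¹ * ((τ : S.Gk) : G) ∈ K}.Finite ∧
      {τ : S.T'k | g⁻¹ * ((τ : S.Gk) : G) ∈ K}.ncard ≤ n := by
  classical
  obtain ⟨n, hn⟩ := exists_card_le_t'k_of_isCompact S hK
  refine ⟨n, fun g => ?_⟩
  have hfin : {τ : S.T'k | g⁻¹ * ((τ : S.Gk) : G) ∈ K}.Finite := by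
    by_contra hinf
    obtain ⟨F, hFsub, hFcard⟩ := (Set.not_finite.mp hinf).exists_subset_card_eq (n + 1)
    have := hn g F fun τ hτ => hFsub hτ
    omega
  refine ⟨hfin, ?_⟩
  rw [Set.ncard_eq_toFinset_card _ hfin]
  exact hn g _ fun τ hτ => hfin.mem_toFinset.mp hτ

end Generic

/-! ## 2. Adelic: `T(k) ∩ (T_∞ × K_f)` on a plane whose archimedean torus is compact -/

section Adelic

variable {k : Type} [Field k] [NumberField k] (W : PlaneData k)

/-- `T(𝔸) ∩ G_∞` is a compact subset of `G(𝔸)` when `torusInf W` is a compact space: it is the range of the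
continuous map `torusInf W → G(𝔸)`. -/
theorem isCompact_torusT_inter_infinitePart [CompactSpace (torusInf W)] :
    IsCompact ((torusT W : Set (GA W)) ∩ (infinitePart W : Set (GA W))) := by
  have hrange : (torusT W : Set (GA W)) ∩ (infinitePart W : Set (GA W)) =
      Set.range (fun t : torusInf W => ((t : torusT W) : GA W)) := by
    ext g
    constructor
    · rintro ⟨hT, hinf⟩
      exact ⟨⟨⟨g, hT⟩, Subgroup.mem_subgroupOf.2 hinf⟩, rfl⟩
    · rintro ⟨t, rfl⟩
      exact ⟨(t : torusT W).2, Subgroup.mem_subgroupOf.1 t.2⟩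
  rw [hrange]
  exact isCompact_range (continuous_subtype_val.comp continuous_subtype_val)

/-- The `T′` twin: `T′(𝔸) ∩ G_∞` is compact when `torusInf' W` is a compact space. -/
theorem isCompact_torusT'_inter_infinitePart [CompactSpace (torusInf' W)] :
    IsCompact ((torusT' W : Set (GA W)) ∩ (infinitePart W : Set (GA W))) := by
  have hrange : (torusT' W : Set (GA W)) ∩ (infinitePart W : Set (GA W)) =
      Set.range (fun t : torusInf' W => ((t : torusT' W) : GA W)) := by
    ext g
    constructor
    · rintro ⟨hT, hinf⟩
      exact ⟨⟨⟨g, hT⟩, Subgroup.mem_subgroupOf.2 hinf⟩, rfl⟩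
    · rintro ⟨t, rfl⟩
      exact ⟨(t : torusT' W).2, Subgroup.mem_subgroupOf.1 t.2⟩
  rw [hrange]
  exact isCompact_range (continuous_subtype_val.comp continuous_subtype_val)

/-- A torus element with finite part in `K_f` lies in the compact `(T(𝔸) ∩ G_∞) · K_f`: `τ = τ_∞ · τ_f`. -/
theorem mem_mul_of_ofFinPart_mem {Kf : Set (GA W)} {τ : GA W} (hτ : τ ∈ torusT W) (hf : GA.ofFinPart W τ ∈ Kf) :
    τ ∈ ((torusT W : Set (GA W)) ∩ (infinitePart W : Set (GA W))) * Kf := by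
  rw [← GA.ofInfPart_mul_ofFinPart W τ]
  exact Set.mul_mem_mul ⟨ofInfPart_mem_torusT W hτ, GA.ofInfPart_mem_infinitePart W τ⟩ hf

/-- The `T′` twin. -/
theorem mem_mul_of_ofFinPart_mem' {Kf : Set (GA W)} {τ : GA W} (hτ : τ ∈ torusT' W) (hf : GA.ofFinPart W τ ∈ Kf) :
    τ ∈ ((torusT' W : Set (GA W)) ∩ (infinitePart W : Set (GA W))) * Kf := by
  rw [← GA.ofInfPart_mul_ofFinPart W τ]
  exact Set.mul_mem_mul ⟨ofInfPart_mem_torusT' W hτ, GA.ofInfPart_mem_infinitePart W τ⟩ hf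

variable [MeasurableSpace (GA W)] (S : Setting (GA W))

/-- **C-L4-TORUSFIN (R-24)**: on a plane whose archimedean torus `T_∞` is compact, the rational torus points `τ ∈ T(k)`
whose finite part lies in a compact `K_f ⊆ G(𝔸)` are at most `F = F(K_f)` in number — `#(T(k) ∩ (T_∞ × K_f)) ≤ F`:
`τ = τ_∞ τ_f ∈ (T(𝔸) ∩ G_∞) · K_f`, a compact, and `T(k)` is discrete (§1). -/
theorem exists_card_le_tk_of_isCompact_finPart [CompactSpace (torusInf W)] (hT : S.T ≤ torusT W)
    {Kf : Set (GA W)} (hKf : IsCompact Kf) :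
    ∃ F : ℕ, ∀ s : Finset S.Tk, (∀ τ ∈ s, GA.ofFinPart W ((τ : S.Gk) : GA W) ∈ Kf) → s.card ≤ F := by
  classical
  obtain ⟨n, hn⟩ := exists_card_le_tk_of_isCompact S ((isCompact_torusT_inter_infinitePart W).mul hKf)
  refine ⟨n, fun s hs => hn 1 s fun τ hτ => ?_⟩
  rw [inv_one, one_mul]
  exact mem_mul_of_ofFinPart_mem W (hT (Subgroup.mem_subgroupOf.1 τ.2)) (hs τ hτ)

/-- The `T′` twin of C-L4-TORUSFIN: `#(T′(k) ∩ (T′_∞ × K_f)) ≤ F`. -/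
theorem exists_card_le_t'k_of_isCompact_finPart [CompactSpace (torusInf' W)] (hT' : S.T' ≤ torusT' W)
    {Kf : Set (GA W)} (hKf : IsCompact Kf) :
    ∃ F : ℕ, ∀ s : Finset S.T'k, (∀ τ ∈ s, GA.ofFinPart W ((τ : S.Gk) : GA W) ∈ Kf) → s.card ≤ F := by
  classical
  obtain ⟨n, hn⟩ := exists_card_le_t'k_of_isCompact S ((isCompact_torusT'_inter_infinitePart W).mul hKf)
  refine ⟨n, fun s hs => hn 1 s fun τ hτ => ?_⟩
  rw [inv_one, one_mul]
  exact mem_mul_of_ofFinPart_mem' W (hT' (Subgroup.mem_subgroupOf.1 τ.2)) (hs τ hτ)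

/-- The set form of C-L4-TORUSFIN: `{τ ∈ T(k) | τ_f ∈ K_f}` is finite with at most `F` elements. -/
theorem exists_finite_tk_of_isCompact_finPart [CompactSpace (torusInf W)] (hT : S.T ≤ torusT W)
    {Kf : Set (GA W)} (hKf : IsCompact Kf) :
    ∃ F : ℕ, {τ : S.Tk | GA.ofFinPart W ((τ : S.Gk) : GA W) ∈ Kf}.Finite ∧
      {τ : S.Tk | GA.ofFinPart W ((τ : S.Gk) : GA W) ∈ Kf}.ncard ≤ F := by
  classical
  obtain ⟨F, hF⟩ := exists_card_le_tk_of_isCompact_finPart W S hT hKf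
  have hfin : {τ : S.Tk | GA.ofFinPart W ((τ : S.Gk) : GA W) ∈ Kf}.Finite := by
    by_contra hinf
    obtain ⟨s, hsub, hcard⟩ := (Set.not_finite.mp hinf).exists_subset_card_eq (F + 1)
    have := hF s fun τ hτ => hsub hτ
    omega
  refine ⟨F, hfin, ?_⟩
  rw [Set.ncard_eq_toFinset_card _ hfin]
  exact hF _ fun τ hτ => hfin.mem_toFinset.mp hτ

/-- The set form for `T′(k)`. -/
theorem exists_finite_t'k_of_isCompact_finPart [CompactSpace (torusInf' W)] (hT' : S.T' ≤ torusT' W)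
    {Kf : Set (GA W)} (hKf : IsCompact Kf) :
    ∃ F : ℕ, {τ : S.T'k | GA.ofFinPart W ((τ : S.Gk) : GA W) ∈ Kf}.Finite ∧
      {τ : S.T'k | GA.ofFinPart W ((τ : S.Gk) : GA W) ∈ Kf}.ncard ≤ F := by
  classical
  obtain ⟨F, hF⟩ := exists_card_le_t'k_of_isCompact_finPart W S hT' hKf
  have hfin : {τ : S.T'k | GA.ofFinPart W ((τ : S.Gk) : GA W) ∈ Kf}.Finite := by
    by_contra hinf
    obtain ⟨s, hsub, hcard⟩ := (Set.not_finite.mp hinf).exists_subset_card_eq (F + 1)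
    have := hF s fun τ hτ => hsub hτ
    omega
  refine ⟨F, hfin, ?_⟩
  rw [Set.ncard_eq_toFinset_card _ hfin]
  exact hF _ fun τ hτ => hfin.mem_toFinset.mp hτ

end Adelic

end Summit.Ventures.HodgeRepro.Tier4.Line4

end
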